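import Summits.BirchSwinnertonDyer.Rank1Residual.Supersingular.SignedRankZero
import HarnessLib

/-!
# The `p = 2` SHARP-PACKAGE ANOMALY: an EVEN interpolation constant is inconsistent with the verbatim signed package
# (K) + (P) + main-conjecture equality + BSD₂-in-norm-form over the tree's `SignedDatum W 2`
# (cell `b2b-bsdres`, O1 sub-cell `p = 2`; lens-1 GEN 9 rider 9e packet, ported by cc-typer-4 GEN 6 as typer item (27‴))

HONEST FRAMING (run/shared/lean/b2b/bsd-rank1-residual/, verbatim in every file): the goal of the cell is to DELETE
the COMBINATION-SHAPED residual classes of the Birch–Swinnerton-Dyer formula for ALL analytic-rank `≤ 1` elliptic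
curves over `ℚ` — "full BSD formula for every rank `≤ 1` curve in class `C`" assembled STRICTLY from published
theorems — so that the rank-`≤ 1` remainder becomes exactly the CONSTRUCTION-SHAPED classes, which are TYPED
(missing-input `Prop`s), NOT attempted. This is not "finishing BSD". This file is a kernel-checked CONSISTENCY LEMMA
about HYPOTHESIS PACKAGES over the sign-agnostic `SignedDatum W 2` (`Supersingular/SignedRankZero.lean`, p206397):
theorems only, every input an explicit hypothesis on a DATUM; nothing about any curve, Selmer group or `L`-function is
asserted; no definition, no named fact; nothing booked; no RESIDUAL-MAP mark moves. It records WHY the ♯/`+` object at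
`p = 2` cannot be fed verbatim to the tree's rank-0 signed chain (o1 lead C163 (κ), C161 (e) item (27‴) "natural home a
`Literature/Barriers/…` note or `Supersingular/` — typer's call": `Supersingular/`, since this is a cell consistency
lemma about the tree's own hypothesis predicates and not a printed no-go theorem; refuter v13 §83 "(27‴) SHAPE AUDIT …
PASS, kernel-shaped consistency lemma; home = typer's call", with rider R-13.5 quoted below).

CREDIT. This file is the o1 lens-1 GEN 9 rider-9e packet `HOME/b2b-bsdres-o1-idea-1-g9/lean/G9_SharpPackageAnomaly.lean`
(planner-b2b-bsdres-o1-idea-1-g9-0, 2026-08-21T15:33Z; source sha16 `895b9494c1e495e1`), ported VERBATIM up to this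
paragraph and the sub-namespace (`LensOneG9` ↦ the datum theorems in `SignedDatum`, the generic lemma at top level).

THE POINT.  The tree's rank-zero signed chain (`missingLowerBoundAt_of_signedLowerDivisibility` /
`missingUpperBoundAt_of_signedUpperDivisibility`) needs `¬ p ∣ D.c`.  At `p = 2` the interpolation constants of
Sprung's `L♯` at the trivial character are EVEN — `c♯ = −a³ + 2a² + 3a − 4 ∈ {2, 6, −4}` for `a₂ = 2, −2, 0` — while
`c♭ = −a² + 2a + 1 ∈ {1, −7, 1}` is ODD [corpus:paper:arxiv-1601.00010 p0017, table after Cor. 4.11; refuter v13 §83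
engine (D) reproduces `(c♯, c♭) = (2, 1), (6, −7), (−4, 1)`]; Kobayashi's `c₊ = 2` at `a_p = 0` (tree:
`kobayashiConst 2 1 = 2` vs `kobayashiConst 2 (−1) = 1`).  This file shows the evenness is not a nuisance of the chain
but a genuine inconsistency of the VERBATIM package: if a datum satisfies Kim's Euler characteristic (K) verbatim, the
interpolation (P) `L(0) = c·t`, and the main-conjecture EQUALITY `(L) = (ξ)` in `Λ`, then
`‖c‖·‖t‖ = ‖2^{v₂ Tam}‖·‖#Sel‖` (`SignedDatum.norm_c_mul_norm_t_eq`); so if moreover the `2`-part of BSD holds in the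
norm form `‖t‖ = ‖2^{v₂ Tam}‖·‖#Sel‖` with `t ≠ 0` (BSD₂ in rank `0` with `E(ℚ)[2] = 0`, read in `ℚ₂`:
`t = L(E,1)/Ω = #Ш·Tam/#tors²`, `#tors` odd, `Sel_{2^∞} = Ш[2^∞]`), then `‖c‖ = 1`, i.e. `2 ∤ c`
(`SignedDatum.not_two_dvd_c_of_package_of_bsdNorm`).  Contrapositive (`SignedDatum.sharpPackage_inconsistent`): for the
`♯`/`+` object at `2` (even `c`), at least one of {(K) verbatim, (P) with that `c`, `(L♯) = (ξ♯)`} must carry an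
explicit `2^{v₂(c♯)}` correction if BSD₂ is true — the `a₂ = 0 ∧ w₈ = +1` door (where `L♭(−2) = 0` by the lens-1 9b
law and only `♯` is available) is therefore NOT openable with the verbatim package (o1 lead C173 (d): R-L1-G10-C "indexed
♯-door" = the named, unpaid +1 price).  RIDER R-13.5 (refuter v13 §83): a period renormalisation (Ω vs Ω⁺_f, c_∞,
Manin constant) rescales `c♯` AND `c♭` by the SAME 2-power and cannot make both odd, so 'exactly one sign is
verbatim-consistent at 2' is robust, and WHICH sign is fixed by Sprung's printed normalisation.

References (shape only; nothing asserted): S. Kobayashi, Invent. Math. 152 (2003) (3.6) [Kobayashi2003]; B. D. Kim's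
Euler characteristic via A. Ray, F. Sprung, Ann. Inst. Fourier (2025) §1.2 p. 2343 (`f^±(0) ∼ #Sel_p(E/F)·∏ c_ℓ`, no
sign-dependent constant) [RaySprung2025]; F. Sprung, ANT 11 (2017) = arXiv:1601.00010 p. 17 (special values incl. `p = 2`)
[Sprung2017].
-/

set_option autoImplicit false

open PowerSeries

namespace Summit.BirchSwinnertonDyer.Rank1Residual.Supersingular

/-- Associated power series over `ℤ_p` have constant terms of the same norm. [folklore] -/
theorem norm_constantCoeff_eq_of_span_eq_span {p : ℕ} [Fact p.Prime] {L ξ : PowerSeries ℤ_[p]}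
    (h : Ideal.span {L} = Ideal.span {ξ}) :
    ‖constantCoeff L‖ = ‖constantCoeff ξ‖ := by
  rw [Ideal.span_singleton_eq_span_singleton] at h
  obtain ⟨u, hu⟩ := h
  rw [← hu, map_mul, norm_mul]
  have h1 : ‖constantCoeff (u : PowerSeries ℤ_[p])‖ = 1 :=
    PadicInt.isUnit_iff.mp (PowerSeries.isUnit_iff_constantCoeff.mp u.isUnit)
  rw [h1, mul_one]

namespace SignedDatum

variable {W : WeierstrassCurve ℚ}

/-- **The package identity at `p = 2`.** (K) verbatim + (P) `L(0) = c·t` + the main-conjecture equality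
`(L) = (ξ)` force `‖c‖·‖t‖ = ‖2^{v₂ Tam(E)}‖·‖#Sel_{2^∞}(E/ℚ)‖` in `ℚ₂`.  A statement about a DATUM; nothing
asserted. [folklore] -/
theorem norm_c_mul_norm_t_eq (D : SignedDatum W 2) (hK : D.EulerCharacteristic)
    (hfin : Finite (W.selmerGroupPInfty 2)) {t : ℚ}
    (hLt : ((constantCoeff D.L : ℤ_[2]) : ℚ_[2]) = (D.c : ℚ_[2]) * ((t : ℚ) : ℚ_[2]))
    (heq : Ideal.span {D.L} = Ideal.span {D.xi}) :
    ‖(D.c : ℚ_[2])‖ * ‖((t : ℚ) : ℚ_[2])‖ =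
      ‖(2 : ℚ_[2]) ^ padicValNat 2 W.tamagawaProduct‖ * ‖(Nat.card (W.selmerGroupPInfty 2) : ℚ_[2])‖ := by
  obtain ⟨u, hu⟩ := hK hfin
  have hn : ‖((constantCoeff D.L : ℤ_[2]) : ℚ_[2])‖ = ‖((constantCoeff D.xi : ℤ_[2]) : ℚ_[2])‖ := by
    rw [← PadicInt.norm_def, ← PadicInt.norm_def]
    exact norm_constantCoeff_eq_of_span_eq_span heq
  have hu1 : ‖((u : ℤ_[2]) : ℚ_[2])‖ = 1 := by
    rw [← PadicInt.norm_def]; exact PadicInt.isUnit_iff.mp u.isUnit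
  rw [hLt, hu, norm_mul, norm_mul, norm_mul, hu1, one_mul] at hn
  simpa using hn

/-- **Corollary: the `2`-part of BSD in norm form forces an ODD interpolation constant.** If in addition
`‖t‖ = ‖2^{v₂ Tam}‖·‖#Sel‖` (BSD₂ in rank `0` with `E(ℚ)[2] = 0`, read in `ℚ₂`) and `t ≠ 0`, then `2 ∤ c`.
Contrapositive: an even `c` (the `♯`/`+` object at `2`) makes the verbatim package contradict BSD₂.  A statement
about a DATUM; nothing asserted. [folklore] -/
theorem not_two_dvd_c_of_package_of_bsdNorm (D : SignedDatum W 2) (hK : D.EulerCharacteristic)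
    (hfin : Finite (W.selmerGroupPInfty 2)) {t : ℚ} (ht : t ≠ 0)
    (hLt : ((constantCoeff D.L : ℤ_[2]) : ℚ_[2]) = (D.c : ℚ_[2]) * ((t : ℚ) : ℚ_[2]))
    (heq : Ideal.span {D.L} = Ideal.span {D.xi})
    (hbsd : ‖((t : ℚ) : ℚ_[2])‖ =
      ‖(2 : ℚ_[2]) ^ padicValNat 2 W.tamagawaProduct‖ * ‖(Nat.card (W.selmerGroupPInfty 2) : ℚ_[2])‖) :
    ¬ 2 ∣ D.c := by
  have h := norm_c_mul_norm_t_eq D hK hfin hLt heq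
  rw [← hbsd] at h
  have ht' : ‖((t : ℚ) : ℚ_[2])‖ ≠ 0 := by
    rw [norm_ne_zero_iff]; exact_mod_cast ht
  have hc1 : ‖(D.c : ℚ_[2])‖ = 1 := by
    have := mul_right_cancel₀ ht' (h.trans (one_mul _).symm)
    exact this
  intro hdvd
  have hlt : ‖(D.c : ℚ_[2])‖ < 1 := by
    rw [← PadicInt.coe_natCast, ← PadicInt.norm_def, PadicInt.norm_lt_one_iff_dvd]
    obtain ⟨k, hk⟩ := hdvd
    exact ⟨k, by rw [hk]; push_cast; ring⟩
  exact absurd hc1 (ne_of_lt hlt)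

/-- **The same, read as the obstruction for the verbatim `♯`-package**: with an EVEN constant, (K) + (P) + equality
+ BSD₂-norm + `t ≠ 0` is contradictory.  A statement about a DATUM; nothing asserted. [folklore] -/
theorem sharpPackage_inconsistent (D : SignedDatum W 2) (hc : 2 ∣ D.c) (hK : D.EulerCharacteristic)
    (hfin : Finite (W.selmerGroupPInfty 2)) {t : ℚ} (ht : t ≠ 0)
    (hLt : ((constantCoeff D.L : ℤ_[2]) : ℚ_[2]) = (D.c : ℚ_[2]) * ((t : ℚ) : ℚ_[2]))
    (heq : Ideal.span {D.L} = Ideal.span {D.xi})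
    (hbsd : ‖((t : ℚ) : ℚ_[2])‖ =
      ‖(2 : ℚ_[2]) ^ padicValNat 2 W.tamagawaProduct‖ * ‖(Nat.card (W.selmerGroupPInfty 2) : ℚ_[2])‖) :
    False :=
  not_two_dvd_c_of_package_of_bsdNorm D hK hfin ht hLt heq hbsd hc

end SignedDatum

end Summit.BirchSwinnertonDyer.Rank1Residual.Supersingular
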